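import Summits.HodgeConjecture.HodgeConjecture.Theorems.NikulinTwinTransportHodgeSimilitudeAlgebraicTwinTransport
import Summits.HodgeConjecture.HodgeConjecture.Theorems.NikulinTwinTransportTwinSimilitudeAlgebraicTransfer
import Summits.HodgeConjecture.HodgeConjecture.Theorems.NikulinTwinTransportHodgeIsometryAlgebraicComposition

/-!
# Route NikulinTwinTransport · target X (stmt-HodgeConjecture-13674) and crux `HodgeSimilitudeAlgebraic`
# (stmt-HodgeConjecture-13676) — the crux, the target X and Buskin's item on the PRIMITIVE frontier:
# Künneth spanning + moving + Prop. 6.2 + the K3 period facts + twin transport per prime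

Two files of the route now prove Gysin base change for the product square from the SPANNING half of
the Künneth formula: seat 0's `gysin_baseChange_of_kunneth`
(`NikulinTwinTransportHodgeIsometryAlgebraicGysinBaseChange`: all dimensions, input `KunnethSpan` =
every class on `(Y ⊗ Z)(ℂ)` is a combination of cross products `fst^* b ∪ snd^* w`, for all smooth
projective `Y, Z`) and this seat's `baseChange_of_kunneth` (`…HodgeSimilitudeAlgebraicBaseChange`:
surfaces, from the minimal input `KunnethBC` = spanning of the single group `H⁶` + one fibre integral,
with `compCorr_of_kunneth : KunnethBC → CupAlg → CompCorr`). Either discharges the hypothesis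
"composition of algebraic correspondences between surfaces" (`hC` / (C) / `hcomp` / Lemma 6.3 /
`stub_compCorr` of line cm-norm-anchors) of EVERY reduction of this crux modulo Künneth + `CupAlg`
(`N² ∪ N² ⊆ N⁴`, Chow moving); seat 0's `NikulinTwinTransportHodgeIsometryAlgebraicComposition` did the
substitution for item 13675 and for the anchor form of X. This file does it, on the canonical input
`KunnethSpan`, for the TWIN-TRANSPORT forms of X and for THE CRUX, so that each is stated on
hypotheses that are either NAMED FACTS of the tree or primitive inline statements with one printed
source:

* (seat 0, imported: `corrComp_surfaces_of_kunneth'` — `KunnethSpan → CupAlg → CompCorr`, and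
  `hodgeIsometryAlgebraic_of_reflective_of_kunneth` — item 13675 from the two K3 period facts,
  Buskin's Prop. 6.2 at ONE orientation family `μ₀` (`ReflAt[μ₀]`), `KunnethSpan`, `CupAlg`.)
* `twinSimilitudeAlgebraic_of_twinTransport_of_kunneth`, `…_frontier` — the target X from the same
  plus `Huybrechts_K3_hodgeTypes_H2` and ONE twin transport (through this seat's
  `twinSimilitudeAlgebraic_of_twinTransport`), without / with Buskin's item discharged.
* `hodgeSimilitudeAlgebraic_of_prime_twinTransport_of_kunneth`,
  `hodgeSimilitudeAlgebraic_iff_prime_twinTransport_of_kunneth`,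
  `hodgeSimilitudeAlgebraic_of_prime_twinTransport_frontier` — THE CRUX: modulo the three K3 period
  facts, Prop. 6.2 at `μ₀`, `KunnethSpan` and `CupAlg`, `HodgeSimilitudeAlgebraic` follows from
  (and, given Buskin, is equivalent to) twin transport for the rational `q`-similitudes of `Λ_{K3}`,
  one prime `q` at a time.

Nothing here proves a twin transport or Prop. 6.2: those are the research content (open sub-cases of
the Hodge conjecture for `q ≥ 2`; Buskin's twistor argument for `q = 1`).
-/

noncomputable section

open CategoryTheory MonoidalCategory
open scoped Manifold
open Literature.AlgebraicGeometry.Motives Literature.AlgebraicGeometry.HodgeTheory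
open Literature.AlgebraicGeometry.Surfaces Literature.Geometry.Kaehler
open Literature.AlgebraicTopology.SingularHomology
open Summit.HodgeConjecture.HodgeConjecture.Theses.NikulinTwinTransport

namespace Summit.HodgeConjecture.HodgeConjecture.Theorems.NikulinTwinTransport

/-! ### Local notations (verbatim those of the files assembled here) -/

/-- `MarkedK3[S, η, p, x]`: a marked K3 surface with period `x`. Local notation only. -/
local notation3 (prettyPrint := false) "MarkedK3[" S ", " η ", " p ", " x "]" =>
  (IsIntegralClass p ∧
    (∀ q : complexBetti S (2 * 2), IsIntegralClass q → ∃ n : ℤ, q = n • p) ∧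
    (∀ c : complexBetti S (2 * 1), IsIntegralClass c ↔ ∃ v : K3Index → ℤ, η c = fun i => (v i : ℂ)) ∧
    (∀ a b : complexBetti S (2 * 1),
        cupProduct (rfl : 2 * 1 + 2 * 1 = 2 * 2) a b = k3Form (η a) (η b) • p) ∧
    IsOfHodgeType 2 S (2 * 1) 2 0 (LinearEquiv.symm η x) ∧
    (∀ τ : complexBetti S (2 * 1), IsOfHodgeType 2 S (2 * 1) 2 0 τ → ∃ t : ℂ, τ = t • LinearEquiv.symm η x))

/-- `PeriodPt[x]`: a projective period point. Local notation only. -/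
local notation3 (prettyPrint := false) "PeriodPt[" x "]" =>
  (k3Form x x = 0 ∧ 0 < (k3Form (star x) x).re ∧
    ∃ u : K3Index → ℤ, k3Form (fun i => (u i : ℂ)) x = 0 ∧ 0 < ∑ i, ∑ j, u i * k3Gram i j * u j)

/-- `Corr[μ, S, S', hS, hS' ; γ, y] = [γ]_* y`. Local notation only. -/
local notation3 (prettyPrint := false) "Corr[" μ ", " S ", " S' ", " hS ", " hS' " ; " γ ", " y "]" =>
  complexGysin μ
    (IsSmoothProjective.tensor_holds (IsK3Surface.isSmoothProjective hS)
      (IsK3Surface.isSmoothProjective hS'))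
    (IsK3Surface.isSmoothProjective hS) (SemiCartesianMonoidalCategory.fst S S')
    (rfl : 2 * 1 + 2 * 2 + 2 * 2 = 2 * 1 + 2 * (2 + 2))
    (cupProduct (rfl : 2 * 1 + 2 * 2 = 2 * 1 + 2 * 2)
      (complexBetti.map (SemiCartesianMonoidalCategory.snd S S') (2 * 1) y) γ)

/-- `TwinTransportFor[M]`: the twin transport for the endomorphism `M` of `Λ_ℂ`. Local notation only. -/
local notation3 (prettyPrint := false) "TwinTransportFor[" M "]" =>
  ∀ (μ : OrientationFamily), μ.HasPoincareDuality →
    ∀ (S S' : SchemeOver ℂ) (hS : IsK3Surface S) (hS' : IsK3Surface S')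
      (η : complexBetti S (2 * 1) ≃ₗ[ℂ] (K3Index → ℂ)) (p : complexBetti S (2 * 2))
      (x : K3Index → ℂ)
      (η' : complexBetti S' (2 * 1) ≃ₗ[ℂ] (K3Index → ℂ)) (p' : complexBetti S' (2 * 2))
      (x' : K3Index → ℂ),
      MarkedK3[S, η, p, x] → PeriodPt[x] → MarkedK3[S', η', p', x'] → PeriodPt[x'] →
      (∃ t : ℂ, M x' = t • x) →
      ∃ γ ∈ algebraicClasses (MonoidalCategoryStruct.tensorObj S S') 2,
        ∀ y : complexBetti S' (2 * 1), η.symm (M (η' y)) = Corr[μ, S, S', hS, hS' ; γ, y]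

/-- `RatTwinTransportAt[c]`: twin transport for every rational `c`-similitude of `Λ_ℂ` with rational
two-sided inverse. Local notation only. -/
local notation3 (prettyPrint := false) "RatTwinTransportAt[" c "]" =>
  ∀ (M N : Module.End ℂ (K3Index → ℂ)),
    (∀ v : K3Index → ℤ, ∃ w : K3Index → ℚ, M (fun i => (v i : ℂ)) = fun i => (w i : ℂ)) →
    (∀ v : K3Index → ℤ, ∃ w : K3Index → ℚ, N (fun i => (v i : ℂ)) = fun i => (w i : ℂ)) →
    M * N = 1 → N * M = 1 → (∀ a b, k3Form (M a) (M b) = c * k3Form a b) → TwinTransportFor[M]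

/-- `ReflAt[μ₀]`: Buskin's Prop. 6.2 — REFLECTIVE rational Hodge isometries `η⁻¹ ∘ s_v ∘ η'` between
marked projective K3 surfaces are algebraic — at the orientation family `μ₀`; symbol for symbol the
hypothesis `hrefl` of `hodgeIsometryAlgebraic_of_reflective`. Local notation only. -/
local notation3 (prettyPrint := false) "ReflAt[" μ₀ "]" =>
  ∀ (S S' : SchemeOver ℂ) (hS : IsK3Surface S) (hS' : IsK3Surface S')
    (η : complexBetti S (2 * 1) ≃ₗ[ℂ] (K3Index → ℂ)) (p : complexBetti S (2 * 2)) (x : K3Index → ℂ)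
    (η' : complexBetti S' (2 * 1) ≃ₗ[ℂ] (K3Index → ℂ)) (p' : complexBetti S' (2 * 2))
    (x' : K3Index → ℂ),
    MarkedK3[S, η, p, x] → PeriodPt[x] → MarkedK3[S', η', p', x'] → PeriodPt[x'] →
    ∀ v : K3Index → ℤ, ∑ i, ∑ j, v i * k3Gram i j * v j ≠ 0 →
    (∃ t : ℂ, k3ReflectionC v x' = t • x) →
    ∃ γ ∈ algebraicClasses (MonoidalCategoryStruct.tensorObj S S') 2, ∀ y : complexBetti S' (2 * 1),
      η.symm (k3ReflectionC v (η' y)) = Corr[μ₀, S, S', hS, hS' ; γ, y]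

/-- `CupAlg`: `N² H⁴ ∪ N² H⁴ ⊆ N⁴ H⁸` on triple products of surfaces, verbatim from
`NikulinTwinTransportHodgeSimilitudeAlgebraicBaseChange`. Local notation only. -/
local notation3 (prettyPrint := false) "CupAlg" =>
  ∀ (A B C : SchemeOver ℂ), IsSmoothProjective 2 A → IsSmoothProjective 2 B →
    IsSmoothProjective 2 C →
    ∀ a ∈ algebraicClasses (MonoidalCategoryStruct.tensorObj A (MonoidalCategoryStruct.tensorObj B C)) 2,
      ∀ b ∈ algebraicClasses (MonoidalCategoryStruct.tensorObj A (MonoidalCategoryStruct.tensorObj B C)) 2,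
        cupProduct ((Nat.mul_add 2 2 2).symm : 2 * 2 + 2 * 2 = 2 * (2 + 2)) a b ∈
          algebraicClasses (MonoidalCategoryStruct.tensorObj A (MonoidalCategoryStruct.tensorObj B C)) (2 + 2)

/-- `KunnethSpan`: **the spanning half of the Künneth formula** for the complex points of smooth
projective varieties — every class on `(Y ⊗ Z)(ℂ)` is a `ℂ`-combination of cross products
`fst^* b ∪ snd^* w` (Hatcher Thm. 3.15 with Cor. A.12); symbol for symbol the hypothesis `hK` of seat 0's
`gysin_baseChange_of_kunneth`. Local notation only. -/
local notation3 (prettyPrint := false) "KunnethSpan" =>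
  ∀ ⦃m' n' : ℕ⦄ ⦃Y' Z' : SchemeOver ℂ⦄, IsSmoothProjective m' Y' → IsSmoothProjective n' Z' →
    ∀ (k : ℕ) (z : complexBetti (MonoidalCategoryStruct.tensorObj Y' Z') k), z ∈ Submodule.span ℂ
      {v | ∃ (i j : ℕ) (h : i + j = k) (b : complexBetti Y' i) (w : complexBetti Z' j),
        v = cupProduct h (complexBetti.map (SemiCartesianMonoidalCategory.fst Y' Z') i b)
          (complexBetti.map (SemiCartesianMonoidalCategory.snd Y' Z') j w)}

/-! ### The target X on the primitive frontier -/

/-- **X (`TwinSimilitudeAlgebraic`) from Buskin's item, the three K3 facts, Künneth spanning, the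
multiplicativity of algebraic classes and ONE twin transport**: this seat's
`twinSimilitudeAlgebraic_of_twinTransport` with `hcomp` discharged by seat 0's `corrComp_surfaces_of_kunneth'`.
[cite: Buskin2019, Thm. 1.1 and Lemma 6.3] [cite: Huybrechts2016K3, Ch. 6 Rem. 3.3, Ch. 7 Thm. 5.3] -/
theorem twinSimilitudeAlgebraic_of_twinTransport_of_kunneth
    (hB : Theses.NikulinTwinTransport.HodgeIsometryAlgebraic)
    (hP : Huybrechts_K3_periodSurjective_projective) (hM : Huybrechts_K3_marking_exists)
    (hHT : Huybrechts_K3_hodgeTypes_H2) (hK : KunnethSpan) (hCUP : CupAlg)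
    (M N : Module.End ℂ (K3Index → ℂ))
    (hNrat : ∀ v : K3Index → ℤ, ∃ w : K3Index → ℚ, N (fun i => (v i : ℂ)) = fun i => (w i : ℂ))
    (hMN : M * N = 1) (hM2 : ∀ a b, k3Form (M a) (M b) = 2 * k3Form a b)
    (htw : TwinTransportFor[M]) :
    Theses.NikulinTwinTransport.TwinSimilitudeAlgebraic :=
  twinSimilitudeAlgebraic_of_twinTransport hB hP hM hHT
    (fun μ hμ S S' S'' hS hS' hS'' => corrComp_surfaces_of_kunneth' hK hCUP μ hμ S S' S''
      hS.isSmoothProjective hS'.isSmoothProjective hS''.isSmoothProjective)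
    M N hNrat hMN hM2 htw

/-- **X on the primitive frontier**: the three K3 period facts, Prop. 6.2 at `μ₀`, Künneth spanning,
`N² ∪ N² ⊆ N⁴`, and one twin transport (for a rational `2`-similitude `M` of `Λ_ℂ` with rational
inverse — such `M` exist, `exists_twoSimilitude_k3Lattice`) give `TwinSimilitudeAlgebraic`; Buskin's
item is discharged through `hodgeIsometryAlgebraic_of_reflective_of_kunneth`.
[cite: Buskin2019, Thm. 1.1, Prop. 6.2, Lemma 6.3] -/
theorem twinSimilitudeAlgebraic_of_twinTransport_frontier (μ₀ : OrientationFamily)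
    (hP : Huybrechts_K3_periodSurjective_projective) (hM : Huybrechts_K3_marking_exists)
    (hHT : Huybrechts_K3_hodgeTypes_H2) (hrefl : ReflAt[μ₀]) (hK : KunnethSpan) (hCUP : CupAlg)
    (M N : Module.End ℂ (K3Index → ℂ))
    (hNrat : ∀ v : K3Index → ℤ, ∃ w : K3Index → ℚ, N (fun i => (v i : ℂ)) = fun i => (w i : ℂ))
    (hMN : M * N = 1) (hM2 : ∀ a b, k3Form (M a) (M b) = 2 * k3Form a b)
    (htw : TwinTransportFor[M]) :
    Theses.NikulinTwinTransport.TwinSimilitudeAlgebraic :=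
  twinSimilitudeAlgebraic_of_twinTransport_of_kunneth
    (hodgeIsometryAlgebraic_of_reflective_of_kunneth μ₀ hP hM hrefl hK hCUP) hP hM hHT hK hCUP
    M N hNrat hMN hM2 htw

/-! ### The crux on the primitive frontier -/

/-- **The crux from Buskin's item, Künneth spanning, `N² ∪ N² ⊆ N⁴`, the three K3 facts and twin
transport at every prime**: `hodgeSimilitudeAlgebraic_of_prime_twinTransport` with `hC` discharged by
seat 0's `corrComp_surfaces_of_kunneth'`. [cite: Buskin2019, Thm. 1.1 and Lemma 6.3] [cite: Fulton1998, Prop. 16.1.1] -/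
theorem hodgeSimilitudeAlgebraic_of_prime_twinTransport_of_kunneth
    (hB : Theses.NikulinTwinTransport.HodgeIsometryAlgebraic) (hK : KunnethSpan) (hCUP : CupAlg)
    (hP : Huybrechts_K3_periodSurjective_projective) (hMk : Huybrechts_K3_marking_exists)
    (hHT : Huybrechts_K3_hodgeTypes_H2) (htw : ∀ q : ℕ, q.Prime → RatTwinTransportAt[((q : ℕ) : ℂ)]) :
    Theses.NikulinTwinTransport.HodgeSimilitudeAlgebraic :=
  hodgeSimilitudeAlgebraic_of_prime_twinTransport hB (corrComp_surfaces_of_kunneth' hK hCUP) hP hMk hHT htw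

/-- **The crux is EQUIVALENT to twin transport at every prime, modulo Buskin's item, Künneth
spanning, `N² ∪ N² ⊆ N⁴` and the three K3 facts**: `hodgeSimilitudeAlgebraic_iff_prime_twinTransport`
with `hC` discharged by seat 0's `corrComp_surfaces_of_kunneth'`. [cite: Buskin2019, Thm. 1.1 and Lemma 6.3]
[cite: Fulton1998, Prop. 16.1.1] -/
theorem hodgeSimilitudeAlgebraic_iff_prime_twinTransport_of_kunneth
    (hB : Theses.NikulinTwinTransport.HodgeIsometryAlgebraic) (hK : KunnethSpan) (hCUP : CupAlg)
    (hP : Huybrechts_K3_periodSurjective_projective) (hMk : Huybrechts_K3_marking_exists)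
    (hHT : Huybrechts_K3_hodgeTypes_H2) :
    Theses.NikulinTwinTransport.HodgeSimilitudeAlgebraic ↔
      ∀ q : ℕ, q.Prime → RatTwinTransportAt[((q : ℕ) : ℂ)] :=
  hodgeSimilitudeAlgebraic_iff_prime_twinTransport hB (corrComp_surfaces_of_kunneth' hK hCUP) hP hMk hHT

/-- **THE CRUX ON THE PRIMITIVE FRONTIER.** Granted the named facts
`Huybrechts_K3_periodSurjective_projective`, `Huybrechts_K3_marking_exists`,
`Huybrechts_K3_hodgeTypes_H2`, Buskin's Prop. 6.2 for reflective isometries at ONE orientation family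
`μ₀` (`hrefl`), Künneth spanning `KunnethSpan` and the multiplicativity `CupAlg`: if, for every prime
`q`, the rational `q`-similitudes of the K3 lattice (which exist, `exists_ratSimilitude_k3Lattice`)
admit twin transport, then every rational Hodge similitude between projective K3 surfaces is
algebraic. Buskin's item is discharged through `hodgeIsometryAlgebraic_of_reflective_of_kunneth`;
no hypothesis named "composition of correspondences" or "base change" remains.
[cite: Buskin2019, Thm. 1.1, Prop. 6.2, Lemma 6.3] [cite: Varesco2023, Thm. 2.1] -/
theorem hodgeSimilitudeAlgebraic_of_prime_twinTransport_frontier (μ₀ : OrientationFamily)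
    (hP : Huybrechts_K3_periodSurjective_projective) (hMk : Huybrechts_K3_marking_exists)
    (hHT : Huybrechts_K3_hodgeTypes_H2) (hrefl : ReflAt[μ₀]) (hK : KunnethSpan) (hCUP : CupAlg)
    (htw : ∀ q : ℕ, q.Prime → RatTwinTransportAt[((q : ℕ) : ℂ)]) :
    Theses.NikulinTwinTransport.HodgeSimilitudeAlgebraic :=
  hodgeSimilitudeAlgebraic_of_prime_twinTransport_of_kunneth
    (hodgeIsometryAlgebraic_of_reflective_of_kunneth μ₀ hP hMk hrefl hK hCUP) hK hCUP hP hMk hHT htw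

end Summit.HodgeConjecture.HodgeConjecture.Theorems.NikulinTwinTransport

end
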